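import Literature.MathematicalPhysics.QuantumFieldTheory.Balaban1983to89.B11Eq98CurrentSlot

/-!
# `Balaban1983to89.B11Eq73KernelColumnsCarrier` — T. Bałaban, *The variational problem and background fields in renormalization group method for
lattice gauge theories*, Commun. Math. Phys. **102** (1985) 277–309 [Balaban1985Variational], (63) p. 287, (68)–(73) pp. 288–289, (85)–(86) p. 291,
(46) p. 285, Prop. 4 (97)–(98) pp. 292–293: **THE KERNEL COLUMNS OF `𝔇 = (δ/δA′)(HD)(A′)` ON THE CARRIERS OF (115) THROUGH THE ONE-BLOCK LETTER OF `H`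
AND THE ONE-BOND COLUMN LETTER OF `𝒞′(A)` — the majorant form of print's Neumann series (68)–(73), giving the weighted column binder `hΘE` of
`B11Eq98CurrentSlot.quadAnalytic_W80` with `θ_E = 2Θ_H^w·G·ℓ`, a function of the LETTERS ONLY** (no bond count, no operator norm of `δ_b`; the
per-lattice supplier `B11Ineq73KernelLettersPerLattice.colSum_kernel_fderiv_Emap_le` pays `κ(∇)` instead)

statement-level skeleton of published theorems with citation tags; proofs where landed; nothing here is a claim about the Yang–Mills mass gap

PDF held: `paper:balaban1985-cmp102-variational-background` (journal page = PDF page + 276); pp. 285–291 read through the verbatim quotations of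
`B11Eq90Transpose` ((63), (85)–(90)), `B11Eq71KernelConcrete`∕`B11Eq73KernelConcrete` ((68)–(73)) and `B11Eq98CurrentSlot` ((86), (97)–(98)).

THE PRINT (verbatim, pp. 288–289).  *«𝔇(A′)δA′ = 𝒞′(X₀)δA′ − ℜ(𝔇(A′)δA′), (68) … |ℜ(c, c′)| ≦ … (69) … Iterating (68) we get a convergent series … |𝔇(A′; c, b)| ≦
O(1)C₃ε₃(Lʲη)^{−d+1}e^{−(1/2)δ₀d(c₋,y)}, b ∈ Bʲ(y), y ∈ Λ_j. (73)»*; p. 291 (86): *«from the bound (73) it follows that |…| ≤ Σ_j Σ_{y∈Λ_j} Σ_{b′∈B_j(y)}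
(Lʲη)^d |J(b′)||H(b′, c)||𝔇₃(A′; c, b)| ≤ … We have gathered together all the constants into an absolute constant O(1).»*

WHY THIS FILE (cell context, pub-balaban NE9; ne9-leaf-01 g96 `LOCATED-after-g96.md` §2 (W)).  The lattice-uniform `cur U` chart
(`Support/NE9CurChartTowerPiLatticeUniformClass`) takes the (L3) slot with `(C₄, a₃)` before the lattice; for the concrete `W80` the binder `hΘE` (weighted
fine columns of the kernel of `(HD)′(A′)`) was available only per lattice.  THIS FILE is the COMPOSITION step of the kernel route: it consumes (i) a one-block
letter `hk(b′, y)` of `H` with fine-column sums `Θ_H` (plain) ∕ `Θ_H^w` (`|·|_{(−3)}`-weighted) — the sequel reads it off (K81) for `H̃_{1,k}` —, (ii) a one-bond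
coarse-column letter `g(y, b)·‖A‖` of `𝒞′(A)` with `Σ_y g(y, b) ≤ G` — this generation's `B11Eq44CKernelColumnTower.norm_fderiv_Cck_single_apply_le` ([4] Prop. 5
(157) on the torus: `G = C₃(Lᵏη)·2^d·2d·L^{−kd}`), and returns `θ_E` in these letters.

DICTIONARY.  Fine carrier `Space115 L η lev₀ lev₁ ∇` over `Bond d Pd`; coarse carrier `NegSup w_B 𝔸` over a finite block index `β` (the chain: `NegSize L η levB 0 𝔸`
over `Bond d m`); `H : NegSup →L Space115`, `C : Space115 → NegSup` in the Sect. C `Regime H 0 C b 0 C₂ c₄ 0 a_C ε_C` with `Prop4Hyp C C₂ c₄`; `HD(A′) = Emap H C ε_C A′`,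
`A = T47 H C ε_C A′`; kernel `k_M(b′, b) = B11Eq90Transpose.kernel M b′ b`; one-block field `δ_yZ = (NegSup.equiv w_B 𝔸).symm (Pi.single y Z)`; one-bond
direction `single115 b X`.

WHAT IS PROVED (sorry-free; no definition; nothing of the paper asserted — the letters are displayed HYPOTHESES with named suppliers).
* §1 `negSup_sum_single`, `flat_apply_eq_sum_single` (`(Hg)(b′) = Σ_y (Hδ_yg(y))(b′)` — the kernel sum of (85)), `negSup_apply_eq_sum_single`, `flat_apply_eq_sum_kernel`.
* §2 **`fderiv_Emap_eq`** — (68) on the carriers: `(HD)′(A′) = H∘𝒞′(A)∘(1 − (HD)′(A′))` on `‖A′‖ < a_C` (chain rule through `HD = H∘C∘T`, `T′ = 1 − (HD)′`).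
* §3 **`opNorm_kernel_fderiv_Emap_le`** — the entrywise majorant inequality `u(b′, b) ≤ ‖A‖Σ_y hk(b′, y)(g(y, b) + Σ_{b″}g(y, b″)u(b″, b))`;
  `colSum_weight_kernel_le` (its `r`-weighted column sums); **`colSum_kernel_fderiv_Emap_le`** — `Σ_{b′}u(b′, b) ≤ 2‖A‖Θ_HG` under `(ε_C + a_C)Θ_HG ≤ ½` (the
  Neumann series (70)–(73) in majorant form); **`colSum_weighted_kernel_fderiv_Emap_le`** — THE BINDER `hΘE`:
  `Σ_{b′}((Lʲ⁽ᵇ⁾η)³/(Lʲ⁽ᵇ′⁾η)³)‖k_{(HD)′(A′)}(b′, b)‖ ≤ 2Θ_H^wGℓ·‖A′‖` on `‖A′‖ < a_C`, `ℓ = (1 − 4bC₂(ε_C + a_C))⁻¹`.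
HONEST SCOPE.  (i) Mechanism on displayed letters; the exponential decay of (73) is not used (column sums suffice for (86)); `θ₃` (the kernel of `(HD₃)′`, «(73) with
ε₃² instead of ε₃») is NOT here (sequel).  (ii) Nothing instantiated at the chain's `H̃_{1,k}`, `C_k` here.  (iii) NOT summit progress (cell pub-balaban: NE9 NOT
PRINTED ∕ NOT PROVED; «NE9 ⇐ the named binders»; row WALLED ON A MODEL (O-NE9-1); spine PROVED 0∕9; rung (B)+1 on a finite T⁴ — NOT infinite volume, NOT mass gap,
NOT BetaPertH, NOT Clay; HONEST DEPENDENCY: continuum YM on T⁴ ⇐ BetaPertH ∧ nine spine estimates (0/9 proved); BetaPertH ⇐ (D1) ∧ (D4) ∧ CAP+tail; G-an2-4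
gates asym, D1 and NE2/3/4).  Filed by the NE9 crux-team leaf seat `b2b-balaban-t4-ne9-formalise-leaf-01` (gen 97); NEW file; imports `B11Eq98CurrentSlot`
ONLY; nothing modified.  Net new unproved facts: 0.
-/

noncomputable section

open scoped BigOperators
open Finset Metric Set Filter Topology

namespace Literature.MathematicalPhysics.QuantumFieldTheory.Balaban1983to89.B11Eq73KernelColumnsCarrier

open Literature.MathematicalPhysics.QuantumFieldTheory.Balaban1983to89.B11Prop6Scheme (Prop4Hyp)
open Literature.MathematicalPhysics.QuantumFieldTheory.Balaban1983to89.B11Eq174Chart (solA Regime)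
open Literature.MathematicalPhysics.QuantumFieldTheory.Balaban1983to89.B11Eq90Transpose (kernel kernel_apply single115 sum_single115 flat115_single115)
open Literature.MathematicalPhysics.QuantumFieldTheory.Balaban1983to89.B11Eq90V0primeCurrent (flat115 flat115_apply)
open Literature.MathematicalPhysics.QuantumFieldTheory.Balaban1983to89.B11Eq90V0GroupComposed (T47 T47_apply norm_T47_le norm_T47_lt fderiv_T47
  differentiableOn_solA)
open Literature.MathematicalPhysics.QuantumFieldTheory.Balaban1983to89.B11Eq80Current (Emap Emap_eq_H Emap_eq analyticOnNhd_Emap)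
open B9SectCLatticeCarrier (Bond)
open B11Eq115Space

variable {𝔸 : Type*} [NormedRing 𝔸] [NormedAlgebra ℂ 𝔸] [FiniteDimensional ℂ 𝔸]
variable {d : ℕ} {Pd : Fin d → ℕ} {L η : ℝ} [Fact (0 < L)] [Fact (0 < η)] {lev₀ : Bond d Pd → ℕ} {κ' : Type*} [Fintype κ']
  {lev₁ : κ' → ℕ} {Dc : (Bond d Pd → 𝔸) →ₗ[ℂ] (κ' → 𝔸)}
variable {β : Type*} [Fintype β] [DecidableEq β] {wB : β → ℝ} [Fact (∀ y, 0 < wB y)]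

/-! ## §1 Kernel bookkeeping on the carriers: decompositions into one-bond pieces -/

section Kernels

omit [FiniteDimensional ℂ 𝔸] [Fact (∀ y, 0 < wB y)] in
/-- A block field is the sum of its one-block pieces. [cite: Balaban1985Variational, (85) p.291] -/
theorem negSup_sum_single (g : NegSup wB 𝔸) :
    ∑ y, (NegSup.equiv wB 𝔸).symm (Pi.single y (NegSup.equiv wB 𝔸 g y)) = g := by
  have h : ∑ y, (NegSup.linearEquiv ℂ wB).symm (Pi.single y (NegSup.equiv wB 𝔸 g y)) = g := by
    rw [← map_sum, Finset.univ_sum_single]; rfl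
  exact h

omit [FiniteDimensional ℂ 𝔸] in
/-- **The fine value of `Hg` through the one-block pieces of `g`**: `(Hg)(b′) = Σ_y (H(δ_y g(y)))(b′)` — the kernel sum `Σ_c H(b′, c)g(c)` of (85).
[cite: Balaban1985Variational, (85) p.291, (46) p.285] -/
theorem flat_apply_eq_sum_single (H : NegSup wB 𝔸 →L[ℂ] Space115 L η lev₀ lev₁ Dc) (g : NegSup wB 𝔸) (b' : Bond d Pd) :
    flat115 (H g) b' = ∑ y, flat115 (H ((NegSup.equiv wB 𝔸).symm (Pi.single y (NegSup.equiv wB 𝔸 g y)))) b' := by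
  conv_lhs => rw [← negSup_sum_single g]
  rw [map_sum, map_sum, Finset.sum_apply]

omit [DecidableEq β] in
/-- **The coarse value of `NY` through the one-bond pieces of `Y`**: `(NY)(y) = Σ_b (N(δ_b Y(b)))(y)`. [cite: Balaban1985Variational, (63) p.287, (90) p.291] -/
theorem negSup_apply_eq_sum_single (N : Space115 L η lev₀ lev₁ Dc →L[ℂ] NegSup wB 𝔸) (Y : Space115 L η lev₀ lev₁ Dc) (y : β) :
    NegSup.equiv wB 𝔸 (N Y) y = ∑ b, NegSup.equiv wB 𝔸 (N (single115 (lev₁ := lev₁) (Dc := Dc) b (flat115 Y b))) y := by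
  conv_lhs => rw [← sum_single115 (lev₁ := lev₁) (Dc := Dc) Y]
  rw [map_sum, ← NegSup.evalCLM_apply (𝕜 := ℂ), map_sum]
  rfl

/-- The fine value of `MY` through the one-bond pieces of `Y`: `(MY)(b′) = Σ_b k_M(b′, b)Y(b)`. [cite: Balaban1985Variational, (63) p.287] -/
theorem flat_apply_eq_sum_kernel (M : Space115 L η lev₀ lev₁ Dc →L[ℂ] Space115 L η lev₀ lev₁ Dc) (Y : Space115 L η lev₀ lev₁ Dc) (b' : Bond d Pd) :
    flat115 (M Y) b' = ∑ b, kernel M b' b (flat115 Y b) := by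
  conv_lhs => rw [← sum_single115 (lev₁ := lev₁) (Dc := Dc) Y]
  rw [map_sum, map_sum, Finset.sum_apply]
  rfl

end Kernels

/-! ## §2 The derivative of `HD(A′)` on the ball: `(HD)′(A′) = H·𝒞′(A)·(1 − (HD)′(A′))` ((63), (68)) -/

section Derivative

variable {H : NegSup wB 𝔸 →L[ℂ] Space115 L η lev₀ lev₁ Dc} {C : Space115 L η lev₀ lev₁ Dc → NegSup wB 𝔸} {b C₂ c₄ aC εC : ℝ}

omit [DecidableEq β] in
/-- **(68) ON THE CARRIERS**: the derivative `𝔇 = (δ/δA′)(HD)(A′)` of the Sect. C map satisfies `(HD)′(A′) = H∘𝒞′(A)∘(1 − (HD)′(A′))`, `A = A′ − HD(A′)`,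
`𝒞′(A)` the Fréchet derivative of the letter `C` at `A` — the chain rule through `HD = H∘C∘T` ((47)–(49)) and `T′ = 1 − (HD)′` (`fderiv_T47`); print's
«𝔇h = 𝒞′(X₀)h − ℜ(𝔇h)» (68) before multiplication by `H`. [cite: Balaban1985Variational, (63) p.287, (68) p.288, (47)–(49) p.285] -/
theorem fderiv_Emap_eq (RC : Regime H 0 C b 0 C₂ c₄ 0 aC εC) (hC : Prop4Hyp C C₂ c₄) {A' : Space115 L η lev₀ lev₁ Dc} (hA' : ‖A'‖ < aC) :
    fderiv ℂ (Emap H C εC) A' =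
      H.comp ((fderiv ℂ C (T47 H C εC A')).comp (ContinuousLinearMap.id ℂ _ - fderiv ℂ (Emap H C εC) A')) := by
  have haC : 0 < aC := (norm_nonneg _).trans_lt hA'
  -- `HD = H∘C∘T` near `A′`
  have hev : Emap H C εC =ᶠ[𝓝 A'] fun Z => H (C (T47 H C εC Z)) := by
    filter_upwards [isOpen_ball.mem_nhds (mem_ball_zero_iff.2 hA')] with Z hZ
    exact Emap_eq_H RC (mem_ball_zero_iff.1 hZ)
  -- `C` is differentiable at `A = T A′` (‖A‖ < ε_C + a_C < c₄)
  have hTA : ‖T47 H C εC A'‖ < c₄ := by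
    have h := norm_T47_lt RC hA'
    linarith [RC.dom, RC.ε₄_nonneg]
  have hCd : DifferentiableAt ℂ C (T47 H C εC A') :=
    hC.differentiableOn.differentiableAt ((isOpen_lt continuous_norm continuous_const).mem_nhds hTA)
  have hTd : DifferentiableAt ℂ (T47 H C εC) A' :=
    differentiableAt_id.add ((differentiableOn_solA RC hC).differentiableAt (isOpen_ball.mem_nhds (mem_ball_zero_iff.2 hA')))
  have h1 : fderiv ℂ (fun Z => H (C (T47 H C εC Z))) A' = H.comp ((fderiv ℂ C (T47 H C εC A')).comp (fderiv ℂ (T47 H C εC) A')) := by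
    have := (H.hasFDerivAt.comp A' (hCd.hasFDerivAt.comp A' hTd.hasFDerivAt)).fderiv
    exact this
  -- `1 + (−HD)′ = 1 − (HD)′`
  have hneg : fderiv ℂ (Emap H C εC) A' = -fderiv ℂ (solA H 0 C 0 εC) A' := by
    rw [show Emap H C εC = -(solA H 0 C 0 εC) from rfl, fderiv_neg]
  conv_lhs => rw [hev.fderiv_eq, h1, fderiv_T47 RC hC hA']
  rw [hneg, sub_neg_eq_add]

end Derivative

/-! ## §3 The kernel columns of `(HD)′(A′)` through the letters of `H` and `𝒞′`: the Neumann∕majorant route (69)–(73) → (86) -/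

section Columns

variable {H : NegSup wB 𝔸 →L[ℂ] Space115 L η lev₀ lev₁ Dc} {C : Space115 L η lev₀ lev₁ Dc → NegSup wB 𝔸} {b C₂ c₄ aC εC : ℝ}
  (RC : Regime H 0 C b 0 C₂ c₄ 0 aC εC) (hC : Prop4Hyp C C₂ c₄)
  {hk : Bond d Pd → β → ℝ} (hk0 : ∀ b' y, 0 ≤ hk b' y)
  (hHk : ∀ (y : β) (Z : 𝔸) (b' : Bond d Pd), ‖flat115 (H ((NegSup.equiv wB 𝔸).symm (Pi.single y Z))) b'‖ ≤ hk b' y * ‖Z‖)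
  {ΘH : ℝ} (hH1 : ∀ y, ∑ b', hk b' y ≤ ΘH)
  {gC : β → Bond d Pd → ℝ} (hgC0 : ∀ y bb, 0 ≤ gC y bb)
  (hCg : ∀ A : Space115 L η lev₀ lev₁ Dc, ‖A‖ < εC + aC → ∀ (bb : Bond d Pd) (X : 𝔸) (y : β),
      ‖NegSup.equiv wB 𝔸 (fderiv ℂ C A (single115 (lev₁ := lev₁) (Dc := Dc) bb X)) y‖ ≤ gC y bb * ‖A‖ * ‖X‖)
  {G : ℝ} (hG : ∀ bb, ∑ y, gC y bb ≤ G) (hq : (εC + aC) * ΘH * G ≤ 1 / 2)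

include RC hC hk0 hHk hgC0 hCg in
/-- **THE ENTRYWISE MAJORANT INEQUALITY FOR THE KERNEL OF `(HD)′(A′)`** (print's (68)–(69) read entrywise through the letters): with
`u(b′, b) = ‖k_{(HD)′(A′)}(b′, b)‖`, `A = A′ − HD(A′)`,
`u(b′, b) ≤ ‖A‖·Σ_y hk(b′, y)·(g(y, b) + Σ_{b″} g(y, b″)u(b″, b))` — from §2's `(HD)′ = H𝒞′(A)(1 − (HD)′)`, the one-block letter `hk` of `H` and the
one-bond column letter `g·‖A‖` of `𝒞′(A)`. [cite: Balaban1985Variational, (68)–(69) p.288, (63) p.287] -/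
theorem opNorm_kernel_fderiv_Emap_le {A' : Space115 L η lev₀ lev₁ Dc} (hA' : ‖A'‖ < aC) (b' bb : Bond d Pd) :
    ‖kernel (fderiv ℂ (Emap H C εC) A') b' bb‖ ≤ ‖T47 H C εC A'‖ *
      ∑ y, hk b' y * (gC y bb + ∑ b'', gC y b'' * ‖kernel (fderiv ℂ (Emap H C εC) A') b'' bb‖) := by
  set K := fderiv ℂ (Emap H C εC) A' with hK
  set A := T47 H C εC A' with hA
  have hAlt : ‖A‖ < εC + aC := norm_T47_lt RC hA'
  have hrhs : 0 ≤ ‖A‖ * ∑ y, hk b' y * (gC y bb + ∑ b'', gC y b'' * ‖kernel K b'' bb‖) :=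
    mul_nonneg (norm_nonneg _) (Finset.sum_nonneg fun y _ => mul_nonneg (hk0 _ _)
      (add_nonneg (hgC0 _ _) (Finset.sum_nonneg fun b'' _ => mul_nonneg (hgC0 _ _) (norm_nonneg _))))
  refine ContinuousLinearMap.opNorm_le_bound _ hrhs fun X => ?_
  -- `k_K(b′, b)X = (H 𝒞′(A)(1 − K) δ_b X)(b′)`
  have hKX : K (single115 (lev₁ := lev₁) (Dc := Dc) bb X) =
      H (fderiv ℂ C A (single115 (lev₁ := lev₁) (Dc := Dc) bb X - K (single115 (lev₁ := lev₁) (Dc := Dc) bb X))) := by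
    conv_lhs => rw [hK, fderiv_Emap_eq RC hC hA']
    rfl
  set g : NegSup wB 𝔸 := fderiv ℂ C A (single115 (lev₁ := lev₁) (Dc := Dc) bb X - K (single115 (lev₁ := lev₁) (Dc := Dc) bb X)) with hg
  -- the one-block pieces of `g`
  have hgy : ∀ y, ‖NegSup.equiv wB 𝔸 g y‖ ≤ ‖A‖ * (gC y bb + ∑ b'', gC y b'' * ‖kernel K b'' bb‖) * ‖X‖ := by
    intro y
    rw [hg, map_sub, NegSup.equiv_sub, Pi.sub_apply]
    have h1 : ‖NegSup.equiv wB 𝔸 (fderiv ℂ C A (single115 (lev₁ := lev₁) (Dc := Dc) bb X)) y‖ ≤ gC y bb * ‖A‖ * ‖X‖ := hCg A hAlt bb X y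
    have h2 : ‖NegSup.equiv wB 𝔸 (fderiv ℂ C A (K (single115 (lev₁ := lev₁) (Dc := Dc) bb X))) y‖ ≤
        ∑ b'', gC y b'' * ‖A‖ * (‖kernel K b'' bb‖ * ‖X‖) := by
      rw [negSup_apply_eq_sum_single]
      refine (norm_sum_le _ _).trans (Finset.sum_le_sum fun b'' _ => ?_)
      refine (hCg A hAlt b'' _ y).trans (mul_le_mul_of_nonneg_left ?_ (mul_nonneg (hgC0 _ _) (norm_nonneg _)))
      rw [← kernel_apply]
      exact (kernel K b'' bb).le_opNorm X
    calc _ ≤ ‖NegSup.equiv wB 𝔸 (fderiv ℂ C A (single115 (lev₁ := lev₁) (Dc := Dc) bb X)) y‖ +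
          ‖NegSup.equiv wB 𝔸 (fderiv ℂ C A (K (single115 (lev₁ := lev₁) (Dc := Dc) bb X))) y‖ := norm_sub_le _ _
      _ ≤ gC y bb * ‖A‖ * ‖X‖ + ∑ b'', gC y b'' * ‖A‖ * (‖kernel K b'' bb‖ * ‖X‖) := add_le_add h1 h2
      _ = ‖A‖ * (gC y bb + ∑ b'', gC y b'' * ‖kernel K b'' bb‖) * ‖X‖ := by
          rw [mul_add, add_mul, Finset.mul_sum, Finset.sum_mul]
          congr 1
          · ring
          · exact Finset.sum_congr rfl fun _ _ => by ring
  rw [kernel_apply, hKX, flat_apply_eq_sum_single]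
  calc ‖∑ y, flat115 (H ((NegSup.equiv wB 𝔸).symm (Pi.single y (NegSup.equiv wB 𝔸 g y)))) b'‖
      ≤ ∑ y, hk b' y * ‖NegSup.equiv wB 𝔸 g y‖ := (norm_sum_le _ _).trans (Finset.sum_le_sum fun y _ => hHk y _ b')
    _ ≤ ∑ y, hk b' y * (‖A‖ * (gC y bb + ∑ b'', gC y b'' * ‖kernel K b'' bb‖) * ‖X‖) :=
        Finset.sum_le_sum fun y _ => mul_le_mul_of_nonneg_left (hgy y) (hk0 _ _)
    _ = ‖A‖ * (∑ y, hk b' y * (gC y bb + ∑ b'', gC y b'' * ‖kernel K b'' bb‖)) * ‖X‖ := by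
        rw [Finset.mul_sum, Finset.sum_mul]; refine Finset.sum_congr rfl fun y _ => ?_; ring

include RC hC hk0 hHk hgC0 hCg hG in
/-- The column sums of the majorant inequality: `Σ_{b′} r(b′)u(b′, b) ≤ ‖A‖·Θ·G·(1 + Σ_{b″}u(b″, b))` whenever `Σ_{b′} r(b′)hk(b′, y) ≤ Θ` for every block
`y` (`r ≥ 0` any fine weight; `r ≡ 1`, `Θ = Θ_H` for the plain column). [cite: Balaban1985Variational, (70)–(71) p.288] -/
theorem colSum_weight_kernel_le {A' : Space115 L η lev₀ lev₁ Dc} (hA' : ‖A'‖ < aC) (bb : Bond d Pd) {r : Bond d Pd → ℝ} (hr : ∀ b', 0 ≤ r b')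
    {Θ : ℝ} (hΘ0 : 0 ≤ Θ) (hΘ : ∀ y, ∑ b', r b' * hk b' y ≤ Θ) :
    ∑ b', r b' * ‖kernel (fderiv ℂ (Emap H C εC) A') b' bb‖ ≤
      ‖T47 H C εC A'‖ * Θ * G * (1 + ∑ b'', ‖kernel (fderiv ℂ (Emap H C εC) A') b'' bb‖) := by
  set K := fderiv ℂ (Emap H C εC) A' with hK
  set T : β → ℝ := fun y => gC y bb + ∑ b'', gC y b'' * ‖kernel K b'' bb‖ with hT
  have hT0 : ∀ y, 0 ≤ T y := fun y => add_nonneg (hgC0 _ _) (Finset.sum_nonneg fun b'' _ => mul_nonneg (hgC0 _ _) (norm_nonneg _))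
  have hG0 : 0 ≤ G := (Finset.sum_nonneg fun y _ => hgC0 y bb).trans (hG bb)
  have hU0 : 0 ≤ ∑ b'', ‖kernel K b'' bb‖ := Finset.sum_nonneg fun _ _ => norm_nonneg _
  -- `Σ_y T(y) ≤ G·(1 + U)`
  have hTsum : ∑ y, T y ≤ G * (1 + ∑ b'', ‖kernel K b'' bb‖) := by
    simp only [hT, Finset.sum_add_distrib]
    rw [Finset.sum_comm, mul_add, mul_one, Finset.mul_sum]
    refine add_le_add (hG bb) (Finset.sum_le_sum fun b'' _ => ?_)
    rw [← Finset.sum_mul]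
    exact mul_le_mul_of_nonneg_right (hG b'') (norm_nonneg _)
  calc ∑ b', r b' * ‖kernel K b' bb‖
      ≤ ∑ b', r b' * (‖T47 H C εC A'‖ * ∑ y, hk b' y * T y) := Finset.sum_le_sum fun b' _ =>
        mul_le_mul_of_nonneg_left (opNorm_kernel_fderiv_Emap_le RC hC hk0 hHk hgC0 hCg hA' b' bb) (hr b')
    _ = ‖T47 H C εC A'‖ * ∑ y, (∑ b', r b' * hk b' y) * T y := by
        rw [Finset.mul_sum]
        simp only [Finset.mul_sum, Finset.sum_mul]
        rw [Finset.sum_comm]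
        refine Finset.sum_congr rfl fun y _ => Finset.sum_congr rfl fun b' _ => ?_; ring
    _ ≤ ‖T47 H C εC A'‖ * ∑ y, Θ * T y :=
        mul_le_mul_of_nonneg_left (Finset.sum_le_sum fun y _ => mul_le_mul_of_nonneg_right (hΘ y) (hT0 y)) (norm_nonneg _)
    _ = ‖T47 H C εC A'‖ * Θ * ∑ y, T y := by rw [← Finset.mul_sum]; ring
    _ ≤ ‖T47 H C εC A'‖ * Θ * (G * (1 + ∑ b'', ‖kernel K b'' bb‖)) :=
        mul_le_mul_of_nonneg_left hTsum (mul_nonneg (norm_nonneg _) hΘ0)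
    _ = _ := by ring

include RC hC hk0 hHk hH1 hgC0 hCg hG hq in
/-- **THE UNWEIGHTED FINE-COLUMN SUM OF THE KERNEL OF `(HD)′(A′)`** (the Neumann series of (70)–(73) summed through the majorants): with
`q = ‖A‖·Θ_H·G ≤ ½` (`(ε_C + a_C)Θ_HG ≤ ½`), `Σ_{b′} ‖k_{(HD)′(A′)}(b′, b)‖ ≤ 2q` — `Θ_H` the fine-column letter of `H` (`Σ_{b′}hk(b′, y) ≤ Θ_H`: print's
`|H(b′, c)|` summed over a block, (46)), `G` the coarse-column letter of `𝒞′` per unit of `‖A‖` ([4] Prop. 5 (157) summed over `c`).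
[cite: Balaban1985Variational, (70)–(73) pp.288–289, (46) p.285] -/
theorem colSum_kernel_fderiv_Emap_le (hΘH : 0 ≤ ΘH) {A' : Space115 L η lev₀ lev₁ Dc} (hA' : ‖A'‖ < aC) (bb : Bond d Pd) :
    ∑ b', ‖kernel (fderiv ℂ (Emap H C εC) A') b' bb‖ ≤ 2 * (‖T47 H C εC A'‖ * ΘH * G) := by
  set U : ℝ := ∑ b', ‖kernel (fderiv ℂ (Emap H C εC) A') b' bb‖ with hU
  have hU0 : 0 ≤ U := Finset.sum_nonneg fun _ _ => norm_nonneg _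
  have hG0 : 0 ≤ G := (Finset.sum_nonneg fun y _ => hgC0 y bb).trans (hG bb)
  have hq1 : ‖T47 H C εC A'‖ * ΘH * G ≤ 1 / 2 :=
    (mul_le_mul_of_nonneg_right (mul_le_mul_of_nonneg_right (norm_T47_lt RC hA').le hΘH) hG0).trans hq
  have h := colSum_weight_kernel_le RC hC hk0 hHk hgC0 hCg hG hA' bb (r := fun _ => 1) (fun _ => zero_le_one) hΘH
    (fun y => by simpa only [one_mul] using hH1 y)
  simp only [one_mul] at h
  -- `U ≤ q(1 + U)`, `q ≤ ½` ⟹ `U ≤ 2q`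
  have hqU : ‖T47 H C εC A'‖ * ΘH * G * U ≤ 1 / 2 * U := mul_le_mul_of_nonneg_right hq1 hU0
  nlinarith [h, hqU]

include RC hC hk0 hHk hH1 hgC0 hCg hG hq in
/-- **THE WEIGHTED FINE-COLUMN LETTER `θ_E` OF THE KERNEL OF `(HD)′(A′)` — print's route (73) → (86) with NO lattice count**: if the `|·|_{(−3)}`-weighted
fine columns of `H`'s one-block letter are bounded, `Σ_{b′}((Lʲ⁽ᵇ⁾η)³/(Lʲ⁽ᵇ′⁾η)³)hk(b′, y) ≤ Θ_H^w`, then on `‖A′‖ < a_C`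
`Σ_{b′}((Lʲ⁽ᵇ⁾η)³/(Lʲ⁽ᵇ′⁾η)³)‖k_{(HD)′(A′)}(b′, b)‖ ≤ 2Θ_H^wG·ℓ·‖A′‖`, `ℓ = (1 − 4bC₂(ε_C + a_C))⁻¹` — the binder `hΘE` of
`B11Eq98CurrentSlot.quadAnalytic_W80` with `θ_E := 2Θ_H^wGℓ`, a function of the letters only. [cite: Balaban1985Variational, (73) p.289, (86) p.291, (57) p.286] -/
theorem colSum_weighted_kernel_fderiv_Emap_le (hΘH : 0 ≤ ΘH) {ΘHw : ℝ} (hΘHw : 0 ≤ ΘHw)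
    (hHw : ∀ (bb : Bond d Pd) (y : β), ∑ b', levWeight L η lev₀ 3 bb / levWeight L η lev₀ 3 b' * hk b' y ≤ ΘHw)
    {A' : Space115 L η lev₀ lev₁ Dc} (hA' : ‖A'‖ < aC) (bb : Bond d Pd) :
    ∑ b', levWeight L η lev₀ 3 bb / levWeight L η lev₀ 3 b' * ‖kernel (fderiv ℂ (Emap H C εC) A') b' bb‖ ≤
      2 * ΘHw * G * (1 / (1 - 4 * b * C₂ * (εC + aC))) * ‖A'‖ := by
  have hw : ∀ b' : Bond d Pd, 0 < levWeight L η lev₀ 3 b' := levWeight_pos (Fact.out : 0 < L) (Fact.out : 0 < η) lev₀ 3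
  have hG0 : 0 ≤ G := (Finset.sum_nonneg fun y _ => hgC0 y bb).trans (hG bb)
  have hU := colSum_kernel_fderiv_Emap_le RC hC hk0 hHk hH1 hgC0 hCg hG hq hΘH hA' bb
  have hq1 : ‖T47 H C εC A'‖ * ΘH * G ≤ 1 / 2 :=
    (mul_le_mul_of_nonneg_right (mul_le_mul_of_nonneg_right (norm_T47_lt RC hA').le hΘH) hG0).trans hq
  have h := colSum_weight_kernel_le RC hC hk0 hHk hgC0 hCg hG hA' bb (r := fun b' => levWeight L η lev₀ 3 bb / levWeight L η lev₀ 3 b')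
    (fun b' => div_nonneg (hw bb).le (hw b').le) hΘHw (hHw bb)
  have hA := norm_T47_le RC hA'
  have h1q : 0 < 1 - 4 * b * C₂ * (εC + aC) := by linarith [RC.contr]
  have hU1 : 1 + ∑ b'', ‖kernel (fderiv ℂ (Emap H C εC) A') b'' bb‖ ≤ 2 := by linarith
  calc _ ≤ ‖T47 H C εC A'‖ * ΘHw * G * (1 + ∑ b'', ‖kernel (fderiv ℂ (Emap H C εC) A') b'' bb‖) := h
    _ ≤ (‖A'‖ / (1 - 4 * b * C₂ * (εC + aC))) * ΘHw * G * 2 := by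
        gcongr
    _ = 2 * ΘHw * G * (1 / (1 - 4 * b * C₂ * (εC + aC))) * ‖A'‖ := by ring

end Columns

end Literature.MathematicalPhysics.QuantumFieldTheory.Balaban1983to89.B11Eq73KernelColumnsCarrier

end
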